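import Literature.NumberTheory.Automorphic.ResGL2BorelReduction
import Literature.NumberTheory.Automorphic.ResGL2UnitCongruence
import Literature.NumberTheory.Automorphic.BorelLatticeUnitsCohomologyFinite
import Literature.NumberTheory.Automorphic.BorelStabilizerCohomology
import HarnessLib

/-!
# The stabilisers of `B(K)⁺` on `GL₂(𝔸_K^∞)/K_f(𝔫)` have finitely generated cohomology

Topic `NumberTheory/Automorphic`; namespace `Literature.NumberTheory.Automorphic`, grouping
sub-namespaces `BorelLattice` (entries of `(a b; 0 d)`) and `ResGLnCohomology` (the receptacle of
`Res_{K/ℚ} GL₂`).  Definitions with bodies and theorems (no named fact, no `sorry`).  Brick (B3,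
stabiliser part) of the Eisenstein half of `ResGLnCohomology.Harder1987_eigensystem_cuspidalOrEisenstein`:
finite generation of the cohomology of the Borel stratum `H^q(B(K)⁺, Fun(GL₂(𝔸_K^∞)/K_f(𝔫), E_λ))`
reduces (`TwistedQuotient.moduleFinite_cohomology_of_finite_cover`) to the finite generation of
`Hⁿ(Γ_x, V)` for the stabilisers `Γ_x ≤ B(K)⁺` of the points `x = diag(t₀, t₁) c K_f(𝔫)` and
`V` finitely generated.  For ANY number field `K` and `𝔫 ≠ 0` (no neatness):

* `ResGLnCohomology.borelPosStabilizer 𝔫 t c ≤ B(K)⁺` and its local description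
  `mem_borelPosStabilizer_iff` (`γ ∈ Γ_x ↔ (d⁻¹ γ d)_v ∈ K_v(|𝔫|_v)` for all `v`, `d = diag(t)`,
  `c ∈ GL₂(𝒪̂)`);
* the SANDWICH `Γ₀ ≤ Γ_x ≤ Γ₂` inside `GL₂(K)` (`borelOf_le_map_borelPosStabilizer`,
  `map_borelPosStabilizer_le_borelBoxUnits`): `Γ₂ = B(Λ_t, 𝓞_K^×, 𝓞_K^×)` the matrices `(a b; 0 d)`
  with `a, d` global units and `b` in the box `Λ_t = {β : |β|_v ≤ |𝔫|_v|t₀|_v|t₁|_v⁻¹}`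
  (`ParallelWeight.borelBox`), and `Γ₀ = B(Λ_t, A, A)` with `A` generated by the independent totally
  positive congruence units `u_i = (f_i²)^{exp}` of `ResGL2UnitCongruence` (`BorelLattice.unitSpan`);
* `finite_borelBoxUnits_quotient` — `Γ₀` has finite index in `Γ₂` (Dirichlet: representatives
  `(ζ ∏ f_i^{c_i}, ζ' ∏ f_i^{c'_i})`, `0 ≤ c < 2 exp`);
* `ResGLnCohomology.moduleFinite_groupCohomology_borelPosStabilizer` — **`Hⁿ(Γ_x, V)` is finitely
  generated** over a Noetherian `k` for `V` finitely generated: `Γ₀` is poly-ℤ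
  (`BorelLattice.moduleFinite_groupCohomology_borelOf`), `Γ₀ ≤ Γ_x` has finite index, finite-index
  ascent (`GroupCohomologyFiniteIndexModuleFinite`).

This is the arithmetic content of [Harder1987, §2] (`Γ ∩ B = Γ_U ⋊ Γ_T`, `Γ_U ≅ 𝔞` a lattice,
`Γ_T` of finite index in the units) combined with [Brown1982CohomologyGroups, VIII §2, (5.1)].

## References

* G. Harder, *Eisenstein cohomology of arithmetic groups. The case GL₂*, Invent. Math. 89 (1987),
  §2 [Harder1987].
* K. S. Brown, *Cohomology of Groups*, GTM 87 (1982), VIII §2 and (5.1) [Brown1982CohomologyGroups].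
-/

noncomputable section

open scoped NumberField
open IsDedekindDomain NumberField CategoryTheory

namespace Literature.NumberTheory.Automorphic

/-! ### Entries, determinant and shape of `(a b; 0 d)` -/

namespace BorelLattice

variable {K : Type} [Field K]

/-- `(a b; 0 d)₀₀ = a`. [folklore] -/
@[simp]
theorem bMat_apply_zero_zero (a : Kˣ) (x : K) (d : Kˣ) :
    ((bMat a x d : GL (Fin 2) K) : Matrix (Fin 2) (Fin 2) K) 0 0 = a := by
  simp [coe_bMat]

/-- `(a b; 0 d)₀₁ = b`. [folklore] -/
@[simp]
theorem bMat_apply_zero_one (a : Kˣ) (x : K) (d : Kˣ) :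
    ((bMat a x d : GL (Fin 2) K) : Matrix (Fin 2) (Fin 2) K) 0 1 = x := by
  simp [coe_bMat]

/-- `(a b; 0 d)₁₀ = 0`. [folklore] -/
@[simp]
theorem bMat_apply_one_zero (a : Kˣ) (x : K) (d : Kˣ) :
    ((bMat a x d : GL (Fin 2) K) : Matrix (Fin 2) (Fin 2) K) 1 0 = 0 := by
  simp [coe_bMat]

/-- `(a b; 0 d)₁₁ = d`. [folklore] -/
@[simp]
theorem bMat_apply_one_one (a : Kˣ) (x : K) (d : Kˣ) :
    ((bMat a x d : GL (Fin 2) K) : Matrix (Fin 2) (Fin 2) K) 1 1 = d := by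
  simp [coe_bMat]

/-- `det (a b; 0 d) = a d`. [folklore] -/
theorem det_bMat (a : Kˣ) (x : K) (d : Kˣ) : Matrix.GeneralLinearGroup.det (bMat a x d) = a * d := by
  refine Units.ext ?_
  rw [Matrix.GeneralLinearGroup.val_det_apply, coe_bMat, Matrix.det_fin_two_of, Units.val_mul]
  ring

/-- `(a b; 0 d)` is upper triangular. [folklore] -/
theorem bMat_mem_borel (a : Kˣ) (x : K) (d : Kˣ) : bMat a x d ∈ ParallelWeight.borel K := by
  rw [ParallelWeight.mem_borel_iff, bMat_apply_one_zero]

/-- **Every upper triangular invertible matrix is some `(a b; 0 d)`.** [folklore] -/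
theorem exists_eq_bMat {g : GL (Fin 2) K} (h : (g : Matrix (Fin 2) (Fin 2) K) 1 0 = 0) :
    ∃ (a d : Kˣ) (x : K), g = bMat a x d := by
  have hdet : (g : Matrix (Fin 2) (Fin 2) K).det =
      (g : Matrix (Fin 2) (Fin 2) K) 0 0 * (g : Matrix (Fin 2) (Fin 2) K) 1 1 := by
    rw [Matrix.det_fin_two, h, mul_zero, sub_zero]
  have hne : (g : Matrix (Fin 2) (Fin 2) K) 0 0 * (g : Matrix (Fin 2) (Fin 2) K) 1 1 ≠ 0 :=
    hdet ▸ Matrix.GeneralLinearGroup.det_ne_zero g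
  refine ⟨Units.mk0 _ (left_ne_zero_of_mul hne), Units.mk0 _ (right_ne_zero_of_mul hne),
    (g : Matrix (Fin 2) (Fin 2) K) 0 1, ?_⟩
  ext i j
  rw [coe_bMat]
  fin_cases i <;> fin_cases j <;> simp [h]

end BorelLattice

namespace ResGLnCohomology

open BigHeckeGLn ParallelWeight BorelLattice UnitCongruence Literature.Algebra.Homology

variable {K : Type} [Field K] [NumberField K]

/-! ### Local analysis of `d⁻¹ ι(a b; 0 d) d` -/

/-- Entries of `d⁻¹ ι(a b; 0 e) d` at `v` are integral when `|a|_v, |e|_v ≤ 1` and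
`|t₀|_v⁻¹ |b|_v |t₁|_v ≤ 1`. [folklore] -/
theorem valued_conj_bMat_apply_le_one (t : Fin 2 → (FiniteAdeleRing (𝓞 K) K)ˣ) {a d : Kˣ} {x : K}
    (v : HeightOneSpectrum (𝓞 K)) (ha : v.valuation K (a : K) ≤ 1) (hd : v.valuation K (d : K) ≤ 1)
    (hx : (Valued.v (((t 0 : (FiniteAdeleRing (𝓞 K) K)ˣ) : FiniteAdeleRing (𝓞 K) K) v))⁻¹ *
      v.valuation K x * Valued.v (((t 1 : (FiniteAdeleRing (𝓞 K) K)ˣ) : FiniteAdeleRing (𝓞 K) K) v) ≤ 1)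
    (i j : Fin 2) :
    Valued.v ((localComponent 2 K v ((glDiagonal 2 (FiniteAdeleRing (𝓞 K) K) t)⁻¹ *
        globalEmbedding 2 K (bMat a x d) * glDiagonal 2 (FiniteAdeleRing (𝓞 K) K) t) :
        Matrix (Fin 2) (Fin 2) (v.adicCompletion K)) i j) ≤ 1 := by
  have h0 := FiniteAdeleRing.valued_apply_ne_zero (R := 𝓞 K) (K := K) (t 0) v
  have h1 := FiniteAdeleRing.valued_apply_ne_zero (R := 𝓞 K) (K := K) (t 1) v
  rw [valued_localComponent_conj_apply]
  fin_cases i <;> fin_cases j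
  · simp only [bMat_apply_zero_zero, Fin.zero_eta, Fin.isValue]
    rw [mul_right_comm, inv_mul_cancel₀ h0, one_mul]
    exact ha
  · simpa using hx
  · simp
  · simp only [bMat_apply_one_one, Fin.mk_one, Fin.isValue]
    rw [mul_right_comm, inv_mul_cancel₀ h1, one_mul]
    exact hd

variable {𝔫 : Ideal (𝓞 K)}

/-- **`d⁻¹ ι(a b; 0 e) d ∈ K_v(|𝔫|_v)`** for `a, e` units `≡ 1 mod 𝔫` and `b` in the box `Λ_t`.
[cite: Harder1987, §2] -/
theorem conj_bMat_mem_valuedCongruenceSubgroup (t : Fin 2 → (FiniteAdeleRing (𝓞 K) K)ˣ) {a d : Kˣ}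
    {x : K} (ha : a ∈ congruentUnits K 𝔫) (hd : d ∈ congruentUnits K 𝔫) (hx : x ∈ borelBox 𝔫 t)
    (v : HeightOneSpectrum (𝓞 K)) :
    localComponent 2 K v ((glDiagonal 2 (FiniteAdeleRing (𝓞 K) K) t)⁻¹ *
        globalEmbedding 2 K (bMat a x d) * glDiagonal 2 (FiniteAdeleRing (𝓞 K) K) t) ∈
      valuedCongruenceSubgroup (Fin 2) (idealRadius K v 𝔫) := by
  have hr1 : idealRadius K v 𝔫 ≤ 1 := idealRadius_le_one' (K := K) v 𝔫
  have hva : v.valuation K (a : K) = 1 := valuation_eq_one_of_mem_globalUnits ha.1 v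
  have hvd : v.valuation K (d : K) = 1 := valuation_eq_one_of_mem_globalUnits hd.1 v
  have hva' : v.valuation K ((a⁻¹ : Kˣ) : K) = 1 :=
    valuation_eq_one_of_mem_globalUnits (Subgroup.inv_mem _ ha.1) v
  have hvd' : v.valuation K ((d⁻¹ : Kˣ) : K) = 1 :=
    valuation_eq_one_of_mem_globalUnits (Subgroup.inv_mem _ hd.1) v
  have hxv : (Valued.v (((t 0 : (FiniteAdeleRing (𝓞 K) K)ˣ) : FiniteAdeleRing (𝓞 K) K) v))⁻¹ *
      v.valuation K x * Valued.v (((t 1 : (FiniteAdeleRing (𝓞 K) K)ˣ) : FiniteAdeleRing (𝓞 K) K) v) ≤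
      idealRadius K v 𝔫 := (conj_le_iff_le_borelBoxRadius 𝔫 t v _).2 (hx v)
  have hx' : (Valued.v (((t 0 : (FiniteAdeleRing (𝓞 K) K)ˣ) : FiniteAdeleRing (𝓞 K) K) v))⁻¹ *
      v.valuation K (-((a⁻¹ : Kˣ) : K) * x * ((d⁻¹ : Kˣ) : K)) *
      Valued.v (((t 1 : (FiniteAdeleRing (𝓞 K) K)ˣ) : FiniteAdeleRing (𝓞 K) K) v) ≤ idealRadius K v 𝔫 := by
    have : v.valuation K (-((a⁻¹ : Kˣ) : K) * x * ((d⁻¹ : Kˣ) : K)) = v.valuation K x := by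
      rw [map_mul, map_mul, Valuation.map_neg, hva', hvd', one_mul, mul_one]
    rw [this]
    exact hxv
  refine mem_valuedCongruenceSubgroup_iff.2 ⟨fun i j =>
    valued_conj_bMat_apply_le_one t v hva.le hvd.le (hxv.trans hr1) i j, fun i j => ?_, fun i j => ?_⟩
  · rw [← map_inv, conj_inv_eq, ← map_inv (globalEmbedding 2 K), bMat_inv]
    exact valued_conj_bMat_apply_le_one t v hva'.le hvd'.le (hx'.trans hr1) i j
  · by_cases hij : i = j
    · subst hij
      rw [valued_localComponent_conj_sub_one_apply_diag]
      fin_cases i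
      · simpa using ha.2 v
      · simpa using hd.2 v
    · rw [localComponent_conj_sub_one_apply_of_ne v hij, valued_localComponent_conj_apply]
      fin_cases i <;> fin_cases j
      · exact absurd rfl hij
      · simpa using hxv
      · simp
      · exact absurd rfl hij

/-! ### The stabilisers of `B(K)⁺` and the embedding into `GL₂(K)` -/

variable (K) in
/-- The inclusion `B(K)⁺ ≤ GL₂(K)⁺ ≤ GL₂(K)` as a homomorphism. [folklore] -/
abbrev borelPosToGL : borelPos K →* GL (Fin 2) K :=
  (glTotPos 2 K).subtype.comp (borelPos K).subtype

omit [NumberField K] in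
/-- The inclusion is injective. [folklore] -/
theorem borelPosToGL_injective : Function.Injective (borelPosToGL K) :=
  fun _ _ h => Subtype.ext (Subtype.ext h)

/-- **The stabiliser `Γ_x ≤ B(K)⁺` of `x = diag(t₀, t₁) c K_f(𝔫) ∈ GL₂(𝔸_K^∞)/K_f(𝔫)`**
(`TwistedQuotient.orbitStabilizer` for the action of `B(K)⁺` through the diagonal embedding).
[cite: Harder1987, §2] -/
abbrev borelPosStabilizer (𝔫 : Ideal (𝓞 K)) (t : Fin 2 → (FiniteAdeleRing (𝓞 K) K)ˣ)
    (c : FiniteAdelicGL 2 K) : Subgroup (borelPos K) :=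
  TwistedQuotient.orbitStabilizer ((diagPos 2 K).comp (borelPos K).subtype) (level 2 K 𝔫)
    ((glDiagonal 2 (FiniteAdeleRing (𝓞 K) K) t * c : FiniteAdelicGL 2 K) :
      FiniteAdelicGL 2 K ⧸ level 2 K 𝔫)

/-- **Local description of the stabiliser**: for `c ∈ GL₂(𝒪̂)`, `γ ∈ Γ_x` iff
`(d⁻¹ γ d)_v ∈ K_v(|𝔫|_v)` for all `v`, `d = diag(t)`. [cite: Harder1987, §2] -/
theorem mem_borelPosStabilizer_iff (t : Fin 2 → (FiniteAdeleRing (𝓞 K) K)ˣ) {c : FiniteAdelicGL 2 K}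
    (hc : c ∈ glFiniteIntegralLevel 2 K) (γ : borelPos K) :
    γ ∈ borelPosStabilizer 𝔫 t c ↔ ∀ v : HeightOneSpectrum (𝓞 K),
      localComponent 2 K v ((glDiagonal 2 (FiniteAdeleRing (𝓞 K) K) t)⁻¹ *
        globalEmbedding 2 K ((γ : glTotPos 2 K) : GL (Fin 2) K) * glDiagonal 2 (FiniteAdeleRing (𝓞 K) K) t) ∈
        valuedCongruenceSubgroup (Fin 2) (idealRadius K v 𝔫) := by
  rw [borelPosStabilizer, TwistedQuotient.mem_orbitStabilizer_iff, MulAction.Quotient.smul_coe, smul_eq_mul,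
    eq_comm, QuotientGroup.eq, ← mul_assoc]
  change (glDiagonal 2 (FiniteAdeleRing (𝓞 K) K) t * c)⁻¹ *
      globalEmbedding 2 K ((γ : glTotPos 2 K) : GL (Fin 2) K) * (glDiagonal 2 (FiniteAdeleRing (𝓞 K) K) t * c) ∈
      (principalCongruenceLevel 2 K 𝔫).comap (GLn.ofFinite 2 K) ↔ _
  rw [inv_mul_mul_mem_comap_principalCongruenceLevel_iff hc, mem_comap_principalCongruenceLevel_iff_localComponent]

omit [NumberField K] in
/-- `(a b; 0 d) ∈ GL₂(K)⁺` when `a d` is totally positive. [folklore] -/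
theorem bMat_mem_glTotPos {a d : Kˣ} (x : K) (h : ∀ τ : K →+* ℝ, 0 < τ ((a : K) * d)) :
    bMat a x d ∈ glTotPos 2 K := by
  rw [mem_glTotPos_iff]
  intro τ
  rw [det_bMat, Units.val_mul]
  exact h τ

/-- `(a b; 0 d)` as an element of `B(K)⁺` (`a d` totally positive). [folklore] -/
def bMatPos (a d : Kˣ) (x : K) (h : ∀ τ : K →+* ℝ, 0 < τ ((a : K) * d)) : borelPos K :=
  ⟨⟨bMat a x d, bMat_mem_glTotPos x h⟩, (mem_borelPos_iff_coe_mem_borel _).2 (bMat_mem_borel a x d)⟩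

omit [NumberField K] in
/-- The image of `bMatPos a d x h` in `GL₂(K)` is `(a x; 0 d)` (definitional). [folklore] -/
@[simp]
theorem borelPosToGL_bMatPos (a d : Kˣ) (x : K) (h : ∀ τ : K →+* ℝ, 0 < τ ((a : K) * d)) :
    borelPosToGL K (bMatPos a d x h) = bMat a x d :=
  rfl

/-! ### The sandwich `Γ₀ ≤ Γ_x ≤ Γ₂` in `GL₂(K)` -/

/-- Global units preserve the box `Λ_t` (left multiplication). [folklore] -/
theorem globalUnits_mul_mem_borelBox (𝔫 : Ideal (𝓞 K)) (t : Fin 2 → (FiniteAdeleRing (𝓞 K) K)ˣ) :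
    ∀ a ∈ globalUnits K, ∀ x ∈ borelBox 𝔫 t, (a : K) * x ∈ borelBox 𝔫 t := by
  intro a ha x hx v
  rw [map_mul, valuation_eq_one_of_mem_globalUnits ha v, one_mul]
  exact hx v

/-- Global units preserve the box `Λ_t` (right multiplication). [folklore] -/
theorem mul_globalUnits_mem_borelBox (𝔫 : Ideal (𝓞 K)) (t : Fin 2 → (FiniteAdeleRing (𝓞 K) K)ˣ) :
    ∀ d ∈ globalUnits K, ∀ x ∈ borelBox 𝔫 t, x * (d : K) ∈ borelBox 𝔫 t := by
  intro d hd x hx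
  rw [mul_comm]
  exact globalUnits_mul_mem_borelBox 𝔫 t d hd x hx

/-- **`Γ₂ = B(Λ_t, 𝓞_K^×, 𝓞_K^×)`**: the matrices `(a b; 0 d)` with `a, d` global units and `b ∈ Λ_t`.
[cite: Harder1987, §2] -/
def borelBoxUnits (𝔫 : Ideal (𝓞 K)) (t : Fin 2 → (FiniteAdeleRing (𝓞 K) K)ˣ) : Subgroup (GL (Fin 2) K) :=
  borelOf (borelBox 𝔫 t) (globalUnits K) (globalUnits K) (globalUnits_mul_mem_borelBox 𝔫 t)
    (mul_globalUnits_mem_borelBox 𝔫 t)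

/-- Membership in `Γ₂` (definitional). [folklore] -/
theorem mem_borelBoxUnits_iff {t : Fin 2 → (FiniteAdeleRing (𝓞 K) K)ˣ} {g : GL (Fin 2) K} :
    g ∈ borelBoxUnits 𝔫 t ↔ ∃ a ∈ globalUnits K, ∃ d ∈ globalUnits K, ∃ b ∈ borelBox 𝔫 t, g = bMat a b d :=
  Iff.rfl

/-- `(a b; 0 d) ∈ Γ₂ ↔ a, d ∈ 𝓞_K^× ∧ b ∈ Λ_t`. [folklore] -/
theorem bMat_mem_borelBoxUnits_iff {t : Fin 2 → (FiniteAdeleRing (𝓞 K) K)ˣ} {a d : Kˣ} {b : K} :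
    bMat a b d ∈ borelBoxUnits 𝔫 t ↔ a ∈ globalUnits K ∧ d ∈ globalUnits K ∧ b ∈ borelBox 𝔫 t :=
  bMat_mem_borelOf_iff

/-- **`Γ_x ≤ Γ₂`**: an element of the stabiliser is `(a b; 0 d)` with `a, d` global units (its
conjugate and the inverse are integral at every `v`) and `b ∈ Λ_t` (the congruence condition on the
`(0,1)` entry). [cite: Harder1987, §2] -/
theorem map_borelPosStabilizer_le_borelBoxUnits (t : Fin 2 → (FiniteAdeleRing (𝓞 K) K)ˣ)
    {c : FiniteAdelicGL 2 K} (hc : c ∈ glFiniteIntegralLevel 2 K) :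
    (borelPosStabilizer 𝔫 t c).map (borelPosToGL K) ≤ borelBoxUnits 𝔫 t := by
  intro g hg
  obtain ⟨γ, hγ, rfl⟩ := Subgroup.mem_map.1 hg
  have h10 : (((γ : glTotPos 2 K) : GL (Fin 2) K) : Matrix (Fin 2) (Fin 2) K) 1 0 = 0 :=
    (mem_borelPos_iff _).1 γ.2
  obtain ⟨a, d, x, hγe⟩ := exists_eq_bMat h10
  rw [mem_borelPosStabilizer_iff t hc, hγe] at hγ
  change ((γ : glTotPos 2 K) : GL (Fin 2) K) ∈ borelBoxUnits 𝔫 t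
  rw [hγe, bMat_mem_borelBoxUnits_iff]
  have hent : ∀ v (i j : Fin 2), Valued.v ((localComponent 2 K v ((glDiagonal 2 (FiniteAdeleRing (𝓞 K) K) t)⁻¹ *
      globalEmbedding 2 K (bMat a x d) * glDiagonal 2 (FiniteAdeleRing (𝓞 K) K) t) :
        Matrix (Fin 2) (Fin 2) (v.adicCompletion K)) i j) ≤ 1 :=
    fun v => (mem_valuedCongruenceSubgroup_iff.1 (hγ v)).1
  have hent' : ∀ v (i j : Fin 2), Valued.v ((localComponent 2 K v ((glDiagonal 2 (FiniteAdeleRing (𝓞 K) K) t)⁻¹ *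
      globalEmbedding 2 K (bMat a⁻¹ (-((a⁻¹ : Kˣ) : K) * x * ((d⁻¹ : Kˣ) : K)) d⁻¹) *
        glDiagonal 2 (FiniteAdeleRing (𝓞 K) K) t) : Matrix (Fin 2) (Fin 2) (v.adicCompletion K)) i j) ≤ 1 := by
    intro v
    have h := (mem_valuedCongruenceSubgroup_iff.1 (hγ v)).2.1
    rw [← map_inv, conj_inv_eq, ← map_inv (globalEmbedding 2 K), bMat_inv] at h
    exact h
  have hcong : ∀ v (i j : Fin 2), Valued.v (((localComponent 2 K v ((glDiagonal 2 (FiniteAdeleRing (𝓞 K) K) t)⁻¹ *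
      globalEmbedding 2 K (bMat a x d) * glDiagonal 2 (FiniteAdeleRing (𝓞 K) K) t) :
        Matrix (Fin 2) (Fin 2) (v.adicCompletion K)) - 1) i j) ≤ idealRadius K v 𝔫 :=
    fun v => (mem_valuedCongruenceSubgroup_iff.1 (hγ v)).2.2
  refine ⟨mem_globalUnits_iff.2 ⟨fun v => ?_, fun v => ?_⟩, mem_globalUnits_iff.2 ⟨fun v => ?_, fun v => ?_⟩,
    fun v => ?_⟩
  · have h0 := FiniteAdeleRing.valued_apply_ne_zero (R := 𝓞 K) (K := K) (t 0) v
    have := hent v 0 0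
    rwa [valued_localComponent_conj_apply, bMat_apply_zero_zero, mul_right_comm, inv_mul_cancel₀ h0,
      one_mul] at this
  · have h0 := FiniteAdeleRing.valued_apply_ne_zero (R := 𝓞 K) (K := K) (t 0) v
    have := hent' v 0 0
    rwa [valued_localComponent_conj_apply, bMat_apply_zero_zero, mul_right_comm, inv_mul_cancel₀ h0,
      one_mul] at this
  · have h1 := FiniteAdeleRing.valued_apply_ne_zero (R := 𝓞 K) (K := K) (t 1) v
    have := hent v 1 1
    rwa [valued_localComponent_conj_apply, bMat_apply_one_one, mul_right_comm, inv_mul_cancel₀ h1,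
      one_mul] at this
  · have h1 := FiniteAdeleRing.valued_apply_ne_zero (R := 𝓞 K) (K := K) (t 1) v
    have := hent' v 1 1
    rwa [valued_localComponent_conj_apply, bMat_apply_one_one, mul_right_comm, inv_mul_cancel₀ h1,
      one_mul] at this
  · have := hcong v 0 1
    rwa [localComponent_conj_sub_one_apply_of_ne v (by decide), valued_localComponent_conj_apply,
      bMat_apply_zero_one, conj_le_iff_le_borelBoxRadius] at this

/-- **`Γ₀ ≤ Γ_x`**: if `A ≤` (units `≡ 1 mod 𝔫`) consists of totally positive elements and
`Λ ≤ Λ_t`, then `B(Λ, A, A) ≤ Γ_x` (inside `GL₂(K)`). [cite: Harder1987, §2] -/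
theorem borelOf_le_map_borelPosStabilizer (t : Fin 2 → (FiniteAdeleRing (𝓞 K) K)ˣ)
    {c : FiniteAdelicGL 2 K} (hc : c ∈ glFiniteIntegralLevel 2 K) {Λ : Submodule ℤ K} {A : Subgroup Kˣ}
    {hA : ∀ a ∈ A, ∀ x ∈ Λ, (a : K) * x ∈ Λ} {hD : ∀ d ∈ A, ∀ x ∈ Λ, x * (d : K) ∈ Λ}
    (hAc : A ≤ congruentUnits K 𝔫) (hApos : ∀ a ∈ A, ∀ τ : K →+* ℝ, 0 < τ (a : K)) (hΛ : Λ ≤ borelBox 𝔫 t) :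
    borelOf Λ A A hA hD ≤ (borelPosStabilizer 𝔫 t c).map (borelPosToGL K) := by
  rintro g ⟨a, ha, d, hd, x, hx, rfl⟩
  have hpos : ∀ τ : K →+* ℝ, 0 < τ ((a : K) * d) := fun τ => by
    rw [map_mul]
    exact mul_pos (hApos a ha τ) (hApos d hd τ)
  refine Subgroup.mem_map.2 ⟨bMatPos a d x hpos, ?_, rfl⟩
  rw [mem_borelPosStabilizer_iff t hc]
  intro v
  exact conj_bMat_mem_valuedCongruenceSubgroup t (hAc ha) (hAc hd) (hΛ hx) v

/-! ### The box is the span of its generators -/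

omit [NumberField K] in
/-- The `ℤ`-span of a generating family of a submodule contained in it is the submodule. [folklore] -/
theorem span_eq_of_generators {r : ℕ} {Λ : Submodule ℤ K} {b : Fin r → K} (hb : ∀ i, b i ∈ Λ)
    (hrepr : ∀ β ∈ Λ, ∃ m : Fin r → ℤ, β = ∑ i, (m i : K) * b i) :
    Submodule.span ℤ (Set.range b) = Λ := by
  refine le_antisymm (Submodule.span_le.2 (Set.range_subset_iff.2 hb)) fun β hβ => ?_
  obtain ⟨m, rfl⟩ := hrepr β hβ
  refine Submodule.sum_mem _ fun i _ => ?_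
  rw [← zsmul_eq_mul]
  exact Submodule.smul_mem _ _ (Submodule.subset_span (Set.mem_range_self i))

omit [NumberField K] in
/-- Unique integer coordinates of `0` give linear independence over `ℤ`. [folklore] -/
theorem linearIndependent_of_unique_zero_repr {r : ℕ} {b : Fin r → K}
    (huniq : ∀ m : Fin r → ℤ, (0 : K) = ∑ i, (m i : K) * b i → m = 0) : LinearIndependent ℤ b := by
  refine Fintype.linearIndependent_iff.2 fun g hg i => ?_
  have h := huniq g (by rw [← hg]; exact Finset.sum_congr rfl fun i _ => zsmul_eq_mul (b i) (g i))
  exact congrFun h i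

/-! ### `Γ₀` has finite index in `Γ₂` -/

/-- The representatives `ζ ∏ f_i^{c_i}` (`ζ` a root of unity, `0 ≤ c_i < 2 exp`) of the units modulo
the subgroup generated by the congruence units `u_i = (f_i²)^{exp}`. [cite: Harder1987, §2] -/
def unitRep (𝔫 : Ideal (𝓞 K)) (p : Units.torsion K × (Fin (Units.rank K) → Fin (2 * UnitCongruence.exponent K 𝔫))) : Kˣ :=
  Units.map (algebraMap (𝓞 K) K : 𝓞 K →* K)
    ((p.1 : (𝓞 K)ˣ) * ∏ i, Units.fundSystem K i ^ (((p.2 i : ℕ) : ℤ)))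

/-- The representatives are global units. [folklore] -/
theorem unitRep_mem_globalUnits (𝔫 : Ideal (𝓞 K))
    (p : Units.torsion K × (Fin (Units.rank K) → Fin (2 * UnitCongruence.exponent K 𝔫))) :
    unitRep 𝔫 p ∈ globalUnits K :=
  map_mem_globalUnits _

/-- **Every global unit is a representative times a product of powers of the `u_i`.** [folklore] -/
theorem exists_unitRep_mul (h𝔫 : 𝔫 ≠ 0) {a : Kˣ} (ha : a ∈ globalUnits K) :
    ∃ p : Units.torsion K × (Fin (Units.rank K) → Fin (2 * UnitCongruence.exponent K 𝔫)),
      ∃ q : Fin (Units.rank K) → ℤ, a = unitRep 𝔫 p * ∏ i, congrUnitK K 𝔫 i ^ q i := by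
  obtain ⟨xa, hxa⟩ : ∃ xa, Units.map (algebraMap (𝓞 K) K : 𝓞 K →* K) xa = a := ha
  obtain ⟨ζ, hζ, c, q, h⟩ := exists_rep h𝔫 xa
  refine ⟨(⟨ζ, hζ⟩, c), q, ?_⟩
  rw [← hxa, h, map_mul, map_prod]
  simp only [map_zpow]
  rfl

/-- **`Γ₀ = B(Λ_t, A, A)` has finite index in `Γ₂ = B(Λ_t, 𝓞_K^×, 𝓞_K^×)`** for `A` the subgroup
generated by the congruence units `u_i`: the quotient is covered by the finitely many
`(ρ 0; 0 ρ')`, `ρ, ρ'` representatives. [cite: Harder1987, §2] -/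
theorem finite_borelBoxUnits_quotient (h𝔫 : 𝔫 ≠ 0) (t : Fin 2 → (FiniteAdeleRing (𝓞 K) K)ˣ)
    {Λ : Submodule ℤ K} (hΛ : Λ = borelBox 𝔫 t)
    {hA : ∀ a ∈ unitSpan (congrUnitK K 𝔫) (Units.rank K), ∀ x ∈ Λ, (a : K) * x ∈ Λ}
    {hD : ∀ d ∈ unitSpan (congrUnitK K 𝔫) (Units.rank K), ∀ x ∈ Λ, x * (d : K) ∈ Λ} :
    Finite (borelBoxUnits 𝔫 t ⧸
      (borelOf Λ (unitSpan (congrUnitK K 𝔫) (Units.rank K)) (unitSpan (congrUnitK K 𝔫) (Units.rank K)) hA hD).subgroupOf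
        (borelBoxUnits 𝔫 t)) := by
  classical
  subst hΛ
  set P := Units.torsion K × (Fin (Units.rank K) → Fin (2 * UnitCongruence.exponent K 𝔫))
  let f : P × P → borelBoxUnits 𝔫 t ⧸
      (borelOf (borelBox 𝔫 t) (unitSpan (congrUnitK K 𝔫) (Units.rank K)) (unitSpan (congrUnitK K 𝔫) (Units.rank K))
        hA hD).subgroupOf (borelBoxUnits 𝔫 t) := fun p =>
    QuotientGroup.mk ⟨bMat (unitRep 𝔫 p.1) 0 (unitRep 𝔫 p.2),
      bMat_mem_borelBoxUnits_iff.2 ⟨unitRep_mem_globalUnits 𝔫 p.1, unitRep_mem_globalUnits 𝔫 p.2, zero_mem _⟩⟩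
  refine Finite.of_surjective f fun y => ?_
  induction y using QuotientGroup.induction_on with
  | H g =>
    obtain ⟨a, ha, d, hd, x, hx, hg⟩ := (mem_borelBoxUnits_iff (𝔫 := 𝔫)).1 g.2
    obtain ⟨p₁, q₁, h₁⟩ := exists_unitRep_mul h𝔫 ha
    obtain ⟨p₂, q₂, h₂⟩ := exists_unitRep_mul h𝔫 hd
    refine ⟨(p₁, p₂), QuotientGroup.eq.2 ?_⟩
    rw [Subgroup.mem_subgroupOf]
    change (bMat (unitRep 𝔫 p₁) 0 (unitRep 𝔫 p₂))⁻¹ * (g : GL (Fin 2) K) ∈ _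
    rw [hg, bMat_inv, bMat_mul, bMat_mem_borelOf_iff]
    refine ⟨⟨q₁, fun l hl => absurd l.2 (not_lt.2 hl), ?_⟩, ⟨q₂, fun l hl => absurd l.2 (not_lt.2 hl), ?_⟩, ?_⟩
    · rw [inv_mul_eq_iff_eq_mul, h₁]
    · rw [inv_mul_eq_iff_eq_mul, h₂]
    · have : (((unitRep 𝔫 p₁)⁻¹ : Kˣ) : K) * x +
          -(((unitRep 𝔫 p₁)⁻¹ : Kˣ) : K) * 0 * (((unitRep 𝔫 p₂)⁻¹ : Kˣ) : K) * (d : K) =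
          (((unitRep 𝔫 p₁)⁻¹ : Kˣ) : K) * x := by ring
      rw [this]
      exact globalUnits_mul_mem_borelBox 𝔫 t _ (Subgroup.inv_mem _ (unitRep_mem_globalUnits 𝔫 p₁)) x hx

/-! ### Finite generation of the cohomology of the stabilisers -/

/-- **The cohomology `Hⁿ(Γ_x, V)` of the stabiliser in `B(K)⁺` of `x = diag(t₀, t₁) c K_f(𝔫)`
(`c ∈ GL₂(𝒪̂_K)`, `𝔫 ≠ 0`) is finitely generated** over a Noetherian `k`, for every representation
`V` of `Γ_x` finitely generated over `k` and every `n`: `Γ₀ = B(Λ_t, A, A)` (poly-ℤ, finitely generated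
cohomology by `BorelLattice.moduleFinite_groupCohomology_borelOf`) has finite index in `Γ_x ≤ Γ₂`.
[cite: Harder1987, §2] [cite: Brown1982CohomologyGroups, VIII §2 and (5.1)] -/
theorem moduleFinite_groupCohomology_borelPosStabilizer (h𝔫 : 𝔫 ≠ 0)
    (t : Fin 2 → (FiniteAdeleRing (𝓞 K) K)ˣ) {c : FiniteAdelicGL 2 K} (hc : c ∈ glFiniteIntegralLevel 2 K)
    {k : Type} [CommRing k] [IsNoetherianRing k] (V : Rep k (borelPosStabilizer 𝔫 t c)) [Module.Finite k V]
    (n : ℕ) : Module.Finite k (groupCohomology V n) := by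
  classical
  -- generators of the box
  obtain ⟨b, hb, hrepr⟩ := exists_generators_borelBox h𝔫 t
  have hspan : Submodule.span ℤ (Set.range b) = borelBox 𝔫 t :=
    span_eq_of_generators hb fun β hβ => (hrepr β hβ).exists
  have hli : LinearIndependent ℤ b := by
    refine linearIndependent_of_unique_zero_repr fun m hm => ?_
    obtain ⟨m₀, -, huniq⟩ := hrepr 0 (zero_mem _)
    have h0 : (0 : K) = ∑ i, ((0 : Fin (Module.finrank ℚ K) → ℤ) i : K) * b i := by simp
    exact (huniq m hm).trans (huniq 0 h0).symm
  -- the congruence units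
  have hu : ∀ e : Fin (Units.rank K) → ℤ, ∏ l, congrUnitK K 𝔫 l ^ e l = 1 → e = 0 :=
    eq_zero_of_prod_zpow_congrUnitK_eq_one h𝔫
  have hAc : unitSpan (congrUnitK K 𝔫) (Units.rank K) ≤ congruentUnits K 𝔫 := by
    rintro _ ⟨e, -, rfl⟩
    exact Subgroup.prod_mem _ fun l _ => Subgroup.zpow_mem _ (congrUnitK_mem_congruentUnits h𝔫 l) _
  have hApos : ∀ a ∈ unitSpan (congrUnitK K 𝔫) (Units.rank K), ∀ τ : K →+* ℝ, 0 < τ (a : K) := by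
    rintro _ ⟨e, -, rfl⟩ τ
    exact pos_prod_zpow_congrUnitK 𝔫 e τ
  have hA : ∀ a ∈ unitSpan (congrUnitK K 𝔫) (Units.rank K), ∀ x ∈ Submodule.span ℤ (Set.range b),
      (a : K) * x ∈ Submodule.span ℤ (Set.range b) := fun a ha x hx => by
    rw [hspan] at hx ⊢
    exact globalUnits_mul_mem_borelBox 𝔫 t a (hAc ha).1 x hx
  have hD : ∀ d ∈ unitSpan (congrUnitK K 𝔫) (Units.rank K), ∀ x ∈ Submodule.span ℤ (Set.range b),
      x * (d : K) ∈ Submodule.span ℤ (Set.range b) := fun d hd x hx => by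
    rw [hspan] at hx ⊢
    exact mul_globalUnits_mem_borelBox 𝔫 t d (hAc hd).1 x hx
  -- the sandwich `Γ₀ ≤ Γ ≤ Γ₂`
  have h01 : borelOf (Submodule.span ℤ (Set.range b)) (unitSpan (congrUnitK K 𝔫) (Units.rank K))
      (unitSpan (congrUnitK K 𝔫) (Units.rank K)) hA hD ≤ (borelPosStabilizer 𝔫 t c).map (borelPosToGL K) :=
    borelOf_le_map_borelPosStabilizer t hc hAc hApos hspan.le
  have h12 : (borelPosStabilizer 𝔫 t c).map (borelPosToGL K) ≤ borelBoxUnits 𝔫 t :=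
    map_borelPosStabilizer_le_borelBoxUnits t hc
  -- finite index
  haveI hfin := finite_borelBoxUnits_quotient h𝔫 t hspan (hA := hA) (hD := hD)
  have hfi2 : ((borelOf (Submodule.span ℤ (Set.range b)) (unitSpan (congrUnitK K 𝔫) (Units.rank K))
      (unitSpan (congrUnitK K 𝔫) (Units.rank K)) hA hD).subgroupOf (borelBoxUnits 𝔫 t)).FiniteIndex :=
    Subgroup.finiteIndex_of_finite_quotient
  haveI : ((borelOf (Submodule.span ℤ (Set.range b)) (unitSpan (congrUnitK K 𝔫) (Units.rank K))
      (unitSpan (congrUnitK K 𝔫) (Units.rank K)) hA hD).subgroupOf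
        ((borelPosStabilizer 𝔫 t c).map (borelPosToGL K))).FiniteIndex :=
    ⟨fun h0 => hfi2.index_ne_zero (Subgroup.relIndex_eq_zero_of_le_right h12 h0)⟩
  -- (FC) for `Γ₀`, then `Γ`, then `Γ_x`
  have hΓ₀ : ∀ (B : Rep k (borelOf (Submodule.span ℤ (Set.range b)) (unitSpan (congrUnitK K 𝔫) (Units.rank K))
      (unitSpan (congrUnitK K 𝔫) (Units.rank K)) hA hD)), Module.Finite k B → ∀ m,
      Module.Finite k (groupCohomology B m) := fun B hB m => by
    haveI := hB
    exact moduleFinite_groupCohomology_borelOf b (congrUnitK K 𝔫) (congrUnitK K 𝔫) hA hD hli hu hu B m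
  have hΓ : ∀ (B : Rep k ((borelPosStabilizer 𝔫 t c).map (borelPosToGL K))), Module.Finite k B → ∀ m,
      Module.Finite k (groupCohomology B m) := fun B hB m => by
    have h' : ∀ (C : Rep k ((borelOf (Submodule.span ℤ (Set.range b)) (unitSpan (congrUnitK K 𝔫) (Units.rank K))
        (unitSpan (congrUnitK K 𝔫) (Units.rank K)) hA hD).subgroupOf ((borelPosStabilizer 𝔫 t c).map (borelPosToGL K)))),
        Module.Finite k C → ∀ m, Module.Finite k (groupCohomology C m) := fun C hC m => by
      haveI := hC
      exact moduleFinite_groupCohomology_of_mulEquiv (Subgroup.subgroupOfEquivOfLe h01).symm hΓ₀ C m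
    exact moduleFinite_groupCohomology_of_finiteIndex _ h' m B hB
  exact moduleFinite_groupCohomology_of_mulEquiv
    (Subgroup.equivMapOfInjective (borelPosStabilizer 𝔫 t c) (borelPosToGL K) borelPosToGL_injective).symm hΓ V n

end ResGLnCohomology

end Literature.NumberTheory.Automorphic

end
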